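import Literature.Combinatorics.Sahi2008.KahnQuestionOne
import Literature.Probability.Percolation.PercolationEvents
import Literature.Probability.LatticeModels.RandomClusterFKG
import HarnessLib

/-!
# The three-point strong Harris–Kleitman inequality for every FKG bond measure, in particular for the
# random-cluster measures with `q ≥ 1` (Gladkov 2024 Thm. 3.2 / Cor. 4.2; Ayyer–Linusson–Ravichandran 2025 Thm. 2.10)

Topic `Literature/Probability/Percolation` (companion of `StrongHarrisThreePoint.lean`, which is the Bernoulli
case `μ = prodBernoulli w` of Gladkov's Corollary 4.2).  Everything here is PROVED (no named fact).

## Sources, verbatim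

N. Gladkov, *A strong FKG inequality for multiple events*, Bull. Lond. Math. Soc. **56** (2024) 2794–2801,
doi:10.1112/blms.13101 = arXiv:2305.02653 [Gladkov2024StrongFKG] (`lit read arxiv:2305.02653`): p. 5,
"**Theorem 3.2.** [Theorem (FKG+)] … In particular, it holds for all measures `µ` with the FKG property"
(the strong Harris–Kleitman inequality `µ(A)µ(B) ≥ e₂(µ(C₁),…,µ(C_k))` for UI measures; tree:
`Literature.Combinatorics.Sahi2008.Kahn2022.strongHarris_of_isFKGMeasure`, `KahnQuestionOne.lean`); p. 6, §4.2,
"**Corollary 4.2.** In the notation above, we have: `P(123) P(1|2|3) ≥ P(12|3) P(13|2) + P(12|3) P(1|23) +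
P(13|2) P(1|23)`.  *Proof.* Note that events `A = (123)`, `B = (1|2|3)`, `C_1 = (1|23)`, `C_2 = (13|2)`,
`C_3 = (12|3)` satisfy the conditions of Theorem 2.1."

A. Ayyer, S. Linusson, M. Ravichandran, *The bunkbed problem and the random cluster model*, arXiv:2509.18788
(2025) [AyyerLinussonRavichandran2025] (`lit read arxiv:2509.18788`, p. 12, verbatim): "In recent work, Gladkov
proved a beautiful strengthening of this. **Theorem 2.10 ([13, Theorem 3.2]).** Let `q ≥ 1` and let
`µ ≡ µ^{RC}_{G,p,q}` be a random cluster measure on a graph `G` and let `a, b, c` be vertices. Then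
`µ(abc)µ(a, b, c) ≥ e₂(µ(ab, c), µ(ac, b), µ(bc, a))`, where `e₂(x, y, z) = xy + xz + yz` is the elementary
symmetric polynomial of degree 2."  (They add, p. 12: "We believe that Theorem 2.10 holds for `q < 1` random
cluster measures as well" — a conjecture, not used here.)

## What is proved

* `threePoint_strongHarris_of_isFKGMeasure` — for EVERY finite measure `ν` on the bond configurations
  `BondConfig V = Set (Sym2 V)` of a finite vertex type whose point weights `S ↦ ν{S}` form an FKG probability
  weight (`IsFKGMeasure`, the lattice condition on `2^{Sym2 V}`), and all vertices `a, b, c`: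
  `ν(ab|c) ν(ac|b) + ν(ab|c) ν(a|bc) + ν(ac|b) ν(a|bc) ≤ ν(abc) ν(a|b|c)`, the five cells written with the
  connection events `openConn` exactly as in `prodBernoulli_threePoint_strongHarris`.  Proof = Gladkov's
  (the printed proof of Cor. 4.2 with Thm. 3.2 in place of Thm. 2.1): the cells `a|bc`, `ac|b`, `ab|c` are
  pairwise disjoint, disjoint from `abc`, their unions with `abc` are the increasing events `{b↔c}`, `{a↔c}`,
  `{a↔b}`, the complement of the union is `a|b|c`; apply `strongHarris_of_isFKGMeasure` over `Fin 3`, halve.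
* `rcMeasure_real_singleton`, `isFKGMeasure_rcMeasure` — the point weights of the random-cluster measure
  `φ^B_{G,p,q}` (`Literature.Probability.LatticeModels.rcMeasure`, any wired set `B`) are `w(ω)/Z` on the edge
  sets of `G` and `0` elsewhere, and for `0 ≤ p ≤ 1`, `q ≥ 1` they form an FKG probability weight on
  `2^{Sym2 V}` (the lattice condition is the tree's `rcWeight_lattice_condition`, Grimmett 2006 Thm. 3.8
  (3.11)).
* `rcMeasure_threePoint_strongHarris` — **Ayyer–Linusson–Ravichandran's Theorem 2.10** (= Gladkov's
  Theorem 3.2 for random-cluster measures): the three-point inequality for `φ^B_{G,p,q}`, every finite graph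
  `G`, `0 ≤ p ≤ 1`, `q ≥ 1`, every wired set `B` (`B = ∅` is the free measure of the quote);
  `rcMeasure_strongHarris` — the general `k`-cell form (Gladkov's Thm. 3.2 verbatim for `φ^B_{G,p,q}`);
  `fkIsing_rcMeasure_threePoint_strongHarris` — the FK–Ising parameters `q = 2`, `p = 1 − e^{−2β}`.

## References

* N. Gladkov, Bull. Lond. Math. Soc. 56 (2024) 2794–2801, Thm. 3.2, Cor. 4.2. [Gladkov2024StrongFKG]
* A. Ayyer, S. Linusson, M. Ravichandran, arXiv:2509.18788 (2025), Thm. 2.10 (p. 12). [AyyerLinussonRavichandran2025]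
* G. Grimmett, *The Random-Cluster Model*, Springer (2006), Thm. 3.8. [Grimmett2006]
-/

noncomputable section

namespace Literature.Probability.Percolation

open MeasureTheory Literature.Probability.LatticeModels Literature.Combinatorics.Sahi2008

variable {V : Type*} [Fintype V]

omit [Fintype V] in
/-- Transitivity of `↔`. [folklore] -/
private theorem openConn_trans'' {x y z : V} {ω : BondConfig V} (h₁ : ω ∈ openConn x y)
    (h₂ : ω ∈ openConn y z) : ω ∈ openConn x z :=
  SimpleGraph.Reachable.trans h₁ h₂

omit [Fintype V] in
/-- Symmetry of `↔`. [folklore] -/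
private theorem openConn_symm'' {x y : V} {ω : BondConfig V} (h : ω ∈ openConn x y) :
    ω ∈ openConn y x :=
  SimpleGraph.Reachable.symm h

/-- **Gladkov 2024, Theorem 3.2 in the three-point form of Corollary 4.2, for every FKG bond measure.**
For a finite measure `ν` on `BondConfig V = 2^{Sym2 V}` (finite vertex type) whose point weights form an FKG
probability weight, and vertices `a, b, c`, with `abc = {a↔b} ∩ {a↔c}`, `ab|c = {a↔b} ∩ {a↔c}ᶜ`,
`ac|b = {a↔c} ∩ {a↔b}ᶜ`, `a|bc = {b↔c} ∩ {a↔b}ᶜ`, `a|b|c = {a↔b}ᶜ ∩ {a↔c}ᶜ ∩ {b↔c}ᶜ`: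
`ν(ab|c) ν(ac|b) + ν(ab|c) ν(a|bc) + ν(ac|b) ν(a|bc) ≤ ν(abc) ν(a|b|c)`.
[cite: Gladkov2024StrongFKG, Thm. 3.2 ("it holds for all measures with the FKG property") and Cor. 4.2] -/
theorem threePoint_strongHarris_of_isFKGMeasure (ν : Measure (BondConfig V)) [IsFiniteMeasure ν]
    (hν : IsFKGMeasure (fun S : BondConfig V => ν.real {S})) (a b c : V) :
    ν.real (openConn a b ∩ (openConn a c)ᶜ) * ν.real (openConn a c ∩ (openConn a b)ᶜ) +
        ν.real (openConn a b ∩ (openConn a c)ᶜ) * ν.real (openConn b c ∩ (openConn a b)ᶜ) +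
        ν.real (openConn a c ∩ (openConn a b)ᶜ) * ν.real (openConn b c ∩ (openConn a b)ᶜ) ≤
      ν.real (openConn a b ∩ openConn a c) *
        ν.real ((openConn a b)ᶜ ∩ (openConn a c)ᶜ ∩ (openConn b c)ᶜ) := by
  classical
  -- the cells of Gladkov's theorem: `A = abc`, `C₀ = a|bc`, `C₁ = ac|b`, `C₂ = ab|c`
  set A : Set (BondConfig V) := openConn a b ∩ openConn a c with hA
  set C₀ : Set (BondConfig V) := openConn b c ∩ (openConn a b)ᶜ with hC₀
  set C₁ : Set (BondConfig V) := openConn a c ∩ (openConn a b)ᶜ with hC₁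
  set C₂ : Set (BondConfig V) := openConn a b ∩ (openConn a c)ᶜ with hC₂
  -- pairwise disjointness
  have d01 : Disjoint C₀ C₁ :=
    Set.disjoint_left.2 fun ω h0 h1 => h0.2 (openConn_trans'' h1.1 (openConn_symm'' h0.1))
  have d02 : Disjoint C₀ C₂ := Set.disjoint_left.2 fun ω h0 h2 => h0.2 h2.1
  have d12 : Disjoint C₁ C₂ := Set.disjoint_left.2 fun ω h1 h2 => h1.2 h2.1
  have dA0 : Disjoint A C₀ := Set.disjoint_left.2 fun ω hA' h0 => h0.2 hA'.1
  have dA1 : Disjoint A C₁ := Set.disjoint_left.2 fun ω hA' h1 => h1.2 hA'.1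
  have dA2 : Disjoint A C₂ := Set.disjoint_left.2 fun ω hA' h2 => h2.2 hA'.2
  -- `A ∪ Cᵢ` are connection events
  have hU0 : A ∪ C₀ = openConn b c := by
    ext ω
    constructor
    · rintro (hA' | h0)
      · exact openConn_trans'' (openConn_symm'' hA'.1) hA'.2
      · exact h0.1
    · intro hbc
      by_cases hab : ω ∈ openConn a b
      · exact Or.inl ⟨hab, openConn_trans'' hab hbc⟩
      · exact Or.inr ⟨hbc, hab⟩
  have hU1 : A ∪ C₁ = openConn a c := by
    ext ω
    constructor
    · rintro (hA' | h1)
      · exact hA'.2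
      · exact h1.1
    · intro hac
      by_cases hab : ω ∈ openConn a b
      · exact Or.inl ⟨hab, hac⟩
      · exact Or.inr ⟨hac, hab⟩
  have hU2 : A ∪ C₂ = openConn a b := by
    ext ω
    constructor
    · rintro (hA' | h2)
      · exact hA'.1
      · exact h2.1
    · intro hab
      by_cases hac : ω ∈ openConn a c
      · exact Or.inl ⟨hab, hac⟩
      · exact Or.inr ⟨hab, hac⟩
  have up0 : IsUpperSet (A ∪ C₀) := by rw [hU0]; exact isUpperSet_openConn b c
  have up1 : IsUpperSet (A ∪ C₁) := by rw [hU1]; exact isUpperSet_openConn a c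
  have up2 : IsUpperSet (A ∪ C₂) := by rw [hU2]; exact isUpperSet_openConn a b
  have hAup : IsUpperSet A := (isUpperSet_openConn a b).inter (isUpperSet_openConn a c)
  -- index the cells by `Fin 3`
  let C : Fin 3 → Set (BondConfig V) := ![C₀, C₁, C₂]
  have e0 : C 0 = C₀ := rfl
  have e1 : C 1 = C₁ := rfl
  have e2 : C 2 = C₂ := rfl
  have hdisj : ∀ i ∈ (Finset.univ : Finset (Fin 3)), ∀ j ∈ (Finset.univ : Finset (Fin 3)),
      i ≠ j → Disjoint (C i) (C j) := by
    intro i _ j _ hij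
    fin_cases i <;> fin_cases j
    all_goals first
      | exact (hij rfl).elim
      | exact d01 | exact d01.symm | exact d02 | exact d02.symm | exact d12 | exact d12.symm
  have hdisjA : ∀ i ∈ (Finset.univ : Finset (Fin 3)), Disjoint A (C i) := by
    intro i _
    fin_cases i
    · exact dA0
    · exact dA1
    · exact dA2
  have hup : ∀ i ∈ (Finset.univ : Finset (Fin 3)), IsUpperSet (A ∪ C i) := by
    intro i _
    fin_cases i
    · exact up0
    · exact up1
    · exact up2
  have key := Kahn2022.strongHarris_of_isFKGMeasure ν hν (Finset.univ : Finset (Fin 3)) hdisj hdisjA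
    hup hAup
  -- identify the bottom cell
  have hB : (A ∪ ⋃ i ∈ (Finset.univ : Finset (Fin 3)), C i)ᶜ =
      (openConn a b)ᶜ ∩ (openConn a c)ᶜ ∩ (openConn b c)ᶜ := by
    have h3 : (⋃ i ∈ (Finset.univ : Finset (Fin 3)), C i) = C₀ ∪ C₁ ∪ C₂ := by
      ext ω
      simp only [Finset.mem_univ, Set.iUnion_true, Set.mem_iUnion, Set.mem_union]
      constructor
      · rintro ⟨i, hi⟩
        fin_cases i
        · exact Or.inl (Or.inl hi)
        · exact Or.inl (Or.inr hi)
        · exact Or.inr hi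
      · rintro ((h | h) | h)
        · exact ⟨0, h⟩
        · exact ⟨1, h⟩
        · exact ⟨2, h⟩
    have hunion : A ∪ (C₀ ∪ C₁ ∪ C₂) = openConn a b ∪ openConn a c ∪ openConn b c := by
      rw [← hU0, ← hU1, ← hU2]
      ext ω; simp only [Set.mem_union]; tauto
    rw [h3, hunion]
    ext ω
    simp only [Set.mem_compl_iff, Set.mem_union, not_or, Set.mem_inter_iff]
  rw [hB] at key
  -- expand the `Fin 3` sums and halve
  simp only [Fin.sum_univ_three, e0, e1, e2] at key
  nlinarith [key]

/-! ### The random-cluster measures with `q ≥ 1` are FKG bond measures -/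

section RandomCluster

variable [DecidableEq V] (G : SimpleGraph V) [DecidableRel G.Adj]

omit [Fintype V] [DecidableEq V] in
/-- `↑ω = S ↔ S.toFinset = ω` for a finset `ω` and a set `S` of edges. [folklore] -/
private theorem coe_eq_iff_toFinset_eq (ω : Finset (Sym2 V)) (S : Set (Sym2 V)) [Fintype S] :
    (↑ω : Set (Sym2 V)) = S ↔ S.toFinset = ω := by
  constructor
  · rintro rfl; exact Finset.toFinset_coe ω
  · rintro rfl; exact Set.coe_toFinset S

open Classical in
/-- The point weights of the random-cluster measure: `φ^B_{G,p,q}({S}) = w(S)/Z` if `S ⊆ E(G)` and `0`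
otherwise (`0 ≤ p ≤ 1`, `0 < q`; `S.toFinset` with the classical decidability instances).
[cite: Grimmett2006, §1.2, eq. (1.2)] -/
theorem rcMeasure_real_singleton {p q : ℝ} (hp : p ∈ Set.Icc (0 : ℝ) 1) (hq : 0 < q) (B : Set V)
    (S : BondConfig V) :
    (rcMeasure G p q B).real {S} =
      (if S.toFinset ⊆ G.edgeFinset then rcWeight G p q B S.toFinset else 0) /
        rcPartitionFunction G p q B := by
  classical
  rw [rcMeasure_real_apply G hp hq B]
  have h : ∀ ω ∈ G.edgeFinset.powerset,
      (if (↑ω : BondConfig V) ∈ ({S} : Set (BondConfig V)) then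
          rcWeight G p q B ω / rcPartitionFunction G p q B else 0) =
        if S.toFinset = ω then rcWeight G p q B ω / rcPartitionFunction G p q B else 0 := by
    intro ω _
    simp_rw [Set.mem_singleton_iff, coe_eq_iff_toFinset_eq]
  rw [Finset.sum_congr rfl h, Finset.sum_ite_eq]
  simp only [Finset.mem_powerset]
  split_ifs <;> simp

/-- **The random-cluster measures with `q ≥ 1` are FKG bond measures**: for `0 ≤ p ≤ 1`, `q ≥ 1` and any
wired set `B`, the point weights `S ↦ φ^B_{G,p,q}({S})` form an FKG probability weight on `2^{Sym2 V}`
(nonnegative, total mass one, lattice condition = Grimmett's (3.11) divided by `Z²`).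
[cite: Grimmett2006, Thm. 3.8, eq. (3.11); FortuinKasteleynGinibre1971, §1] -/
theorem isFKGMeasure_rcMeasure {p q : ℝ} (hp : p ∈ Set.Icc (0 : ℝ) 1) (hq : 1 ≤ q) (B : Set V) :
    IsFKGMeasure (fun S : BondConfig V => (rcMeasure G p q B).real {S}) := by
  classical
  have hq0 : 0 < q := one_pos.trans_le hq
  have hZ := rcPartitionFunction_pos G hp hq0 B
  haveI := isProbabilityMeasure_rcMeasure G hp hq0 B
  refine ⟨fun S => measureReal_nonneg, ?_, fun S T => ?_⟩
  · -- total mass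
    have h := sum_measureReal_singleton (μ := rcMeasure G p q B) (Finset.univ : Finset (BondConfig V))
    rw [Finset.coe_univ, probReal_univ] at h
    exact h
  · -- lattice condition, from `rcWeight_lattice_condition`
    show (rcMeasure G p q B).real {S} * (rcMeasure G p q B).real {T} ≤
      (rcMeasure G p q B).real {S ∩ T} * (rcMeasure G p q B).real {S ∪ T}
    rw [rcMeasure_real_singleton G hp hq0 B, rcMeasure_real_singleton G hp hq0 B,
      rcMeasure_real_singleton G hp hq0 B, rcMeasure_real_singleton G hp hq0 B,
      Set.toFinset_inter, Set.toFinset_union]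
    have key := rcWeight_lattice_condition G hp hq B S.toFinset T.toFinset
    simp only [Finset.inf_eq_inter, Finset.sup_eq_union] at key
    rw [div_mul_div_comm, div_mul_div_comm]
    exact div_le_div_of_nonneg_right key (mul_pos hZ hZ).le

/-- **Ayyer–Linusson–Ravichandran 2025, Theorem 2.10 (= Gladkov 2024, Theorem 3.2 for random-cluster
measures).** "Let `q ≥ 1` and let `µ ≡ µ^{RC}_{G,p,q}` be a random cluster measure on a graph `G` and let
`a, b, c` be vertices. Then `µ(abc)µ(a, b, c) ≥ e₂(µ(ab, c), µ(ac, b), µ(bc, a))`."  Here for the tree's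
`rcMeasure G p q B` (finite graph `G`, `0 ≤ p ≤ 1`, `q ≥ 1`, any wired set `B`; `B = ∅` is the free measure of
the quote), with the cells written with `openConn` as in `threePoint_strongHarris_of_isFKGMeasure`.
[cite: AyyerLinussonRavichandran2025, Thm. 2.10 (p. 12); Gladkov2024StrongFKG, Thm. 3.2 and Cor. 4.2] -/
theorem rcMeasure_threePoint_strongHarris {p q : ℝ} (hp : p ∈ Set.Icc (0 : ℝ) 1) (hq : 1 ≤ q)
    (B : Set V) (a b c : V) :
    (rcMeasure G p q B).real (openConn a b ∩ (openConn a c)ᶜ) *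
          (rcMeasure G p q B).real (openConn a c ∩ (openConn a b)ᶜ) +
        (rcMeasure G p q B).real (openConn a b ∩ (openConn a c)ᶜ) *
          (rcMeasure G p q B).real (openConn b c ∩ (openConn a b)ᶜ) +
        (rcMeasure G p q B).real (openConn a c ∩ (openConn a b)ᶜ) *
          (rcMeasure G p q B).real (openConn b c ∩ (openConn a b)ᶜ) ≤
      (rcMeasure G p q B).real (openConn a b ∩ openConn a c) *
        (rcMeasure G p q B).real ((openConn a b)ᶜ ∩ (openConn a c)ᶜ ∩ (openConn b c)ᶜ) := by
  haveI := isProbabilityMeasure_rcMeasure G hp (one_pos.trans_le hq) B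
  exact threePoint_strongHarris_of_isFKGMeasure _ (isFKGMeasure_rcMeasure G hp hq B) a b c

/-- **Gladkov 2024, Theorem 3.2 (FKG+) for the random-cluster measures — the general `k`-cell form.**  For
`0 ≤ p ≤ 1`, `q ≥ 1`, any wired set `B`, an increasing event `A` and cells `C_i` (`i ∈ s`) pairwise disjoint,
disjoint from `A`, with every `A ∪ C_i` increasing: `(Σ φ(C_i))² − Σ φ(C_i)² ≤ 2 φ(A) φ((A ∪ ⋃ C_i)ᶜ)`, i.e.
`φ(A) φ(B') ≥ e₂(φ(C_i))` with `B' = (A ∪ ⋃ C_i)ᶜ` (Gladkov's "In particular, it holds for all measures with the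
FKG property", applied to `φ^B_{G,p,q}` through `isFKGMeasure_rcMeasure`; the three-cell case is
Ayyer–Linusson–Ravichandran's Thm. 2.10, `rcMeasure_threePoint_strongHarris`).
[cite: Gladkov2024StrongFKG, Thm. 3.2; AyyerLinussonRavichandran2025, Thm. 2.10 (p. 12)] -/
theorem rcMeasure_strongHarris {p q : ℝ} (hp : p ∈ Set.Icc (0 : ℝ) 1) (hq : 1 ≤ q) (B : Set V)
    {ι : Type*} (s : Finset ι) {A : Set (BondConfig V)} {C : ι → Set (BondConfig V)}
    (hdisj : ∀ i ∈ s, ∀ j ∈ s, i ≠ j → Disjoint (C i) (C j))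
    (hdisjA : ∀ i ∈ s, Disjoint A (C i)) (hup : ∀ i ∈ s, IsUpperSet (A ∪ C i)) (hA : IsUpperSet A) :
    (∑ i ∈ s, (rcMeasure G p q B).real (C i)) ^ 2 - ∑ i ∈ s, (rcMeasure G p q B).real (C i) ^ 2 ≤
      2 * ((rcMeasure G p q B).real A * (rcMeasure G p q B).real (A ∪ ⋃ i ∈ s, C i)ᶜ) := by
  haveI := isProbabilityMeasure_rcMeasure G hp (one_pos.trans_le hq) B
  exact Kahn2022.strongHarris_of_isFKGMeasure _ (isFKGMeasure_rcMeasure G hp hq B) s hdisj hdisjA hup hA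

/-- The FK–Ising case (`q = 2`, `p = 1 − e^{−2β}`, `β ≥ 0`) of the three-point strong Harris inequality, for
the random-cluster representation parameters of the tree (`fkIsingParam`).
[cite: Gladkov2024StrongFKG, Thm. 3.2 and Cor. 4.2; Grimmett2006, Thm. 1.10 and §1.4 (the FK–Ising coupling)] -/
theorem fkIsing_rcMeasure_threePoint_strongHarris {β : ℝ} (hβ : 0 ≤ β) (B : Set V) (a b c : V) :
    (rcMeasure G (fkIsingParam β) 2 B).real (openConn a b ∩ (openConn a c)ᶜ) *
          (rcMeasure G (fkIsingParam β) 2 B).real (openConn a c ∩ (openConn a b)ᶜ) +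
        (rcMeasure G (fkIsingParam β) 2 B).real (openConn a b ∩ (openConn a c)ᶜ) *
          (rcMeasure G (fkIsingParam β) 2 B).real (openConn b c ∩ (openConn a b)ᶜ) +
        (rcMeasure G (fkIsingParam β) 2 B).real (openConn a c ∩ (openConn a b)ᶜ) *
          (rcMeasure G (fkIsingParam β) 2 B).real (openConn b c ∩ (openConn a b)ᶜ) ≤
      (rcMeasure G (fkIsingParam β) 2 B).real (openConn a b ∩ openConn a c) *
        (rcMeasure G (fkIsingParam β) 2 B).real
          ((openConn a b)ᶜ ∩ (openConn a c)ᶜ ∩ (openConn b c)ᶜ) :=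
  rcMeasure_threePoint_strongHarris G (fkIsingParam_mem_Icc hβ) one_le_two B a b c

end RandomCluster

end Literature.Probability.Percolation

end
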